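import Summits.ResolutionOfSingularities.ResolutionOfSingularities.Theorems.WeightedInvariantJFlatEssSmoothFaceDescent
import HarnessLib

/-!
# (c11)≤3 for the flat centre filtration `J₃ᵗ = Iota3.jFlatT`, PART 6b-ii/5 — DESCENT OF THE FIRST CONTACT LEVEL (`b = 1`) in
# dimension three: the tangent direction of a better contact parameter is rational (door `HypersurfaceCentreConstruction`,
# stmt-ResolutionOfSingularities-19897; P3 rung clause (c11)≤3; ORDER (o53) PART 6 = GAP 1′, hand res-L1-w43-stub-3)

Topic: `Summits/ResolutionOfSingularities/ResolutionOfSingularities/Theorems`. Helper for the door item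
`HypersurfaceCentreConstruction` (stmt-ResolutionOfSingularities-19897, route `WeightedInvariant`), line `local-engine`
(L W4.3), def-free.  The hypothesis `hcorr` of PART 6a (`JFlatEssSmooth.bMax_map_eq_of_corrections`, p547358) at the level
`b = 1`: `φ : S → S'` local, formally smooth, essentially of finite type, `𝔪_S S' = 𝔪_{S'}`, `dim S' = 3`, `c = (y, x₁, x₂)` a
regular system of parameters of `S`, `f ∈ 𝔪^ν ∖ 𝔪^{ν+1}`, and `g' ∈ 𝔪'` carrying `φ f` to level `2` with
`g' ∉ (φ x₁, φ x₂) + 𝔪'²`.  Then `g' ≡ u · φ(y + r) (mod 𝔪'²)` with `r ∈ (x₁, x₂)` and `u ∈ S'ˣ`.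

* §1 `eq_linear_of_isWeightedHomogeneous_one` — a form of weight `1` for the weights `(1,1,1)` is `F₀ Y + F₁ U₁ + F₂ U₂`.
* §2 **`exists_correction_one`**.  Proof: `φ f = a g'^ν + h`, `h ∈ 𝔪'^{ν+1}`, `a` a unit (PART 6b-ii/2); in the `𝔪'`-adic
  (`(1,1,1)`-weighted) graded ring `in_ν(φ f) = in_ν(f) ⊗ κ(S')` (PART 6b-ii/1) `= ā L^ν`, `L = in_1(g') = l₀ Y + l₁ U₁ + l₂ U₂`
  with `l₀ ≠ 0`; so `in_ν(f) ⊗ κ(S') = ā l₀^ν (Y + R)^ν`, `R = (l₁/l₀) U₁ + (l₂/l₀) U₂`, and PART 6b-ii/3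
  (`exists_eq_map_of_face_identity`, `d = 1`) makes `R` rational: `R = in_1(φ r)`, `r ∈ (x₁, x₂)`; `u` is a lift of `l₀`.

[OURS · L1 W4.3 · (o53)]  Replaces the role of NO printed item; NOT a statement of the manuscript
[claim: Hironaka2017, status: under-review]. AI work, weaker than expert review.  Pure commutative algebra; no named facts.

## References

* H. Hironaka, *Characteristic polyhedra of singularities*, J. Math. Kyoto Univ. 7 (1967), §3. [Hironaka1967]
* V. Cossart, U. Jannsen, S. Saito, LNM 2270 (2020), Def. 8.2, Lemma 8.3. [CossartJannsenSaito2020]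
-/

noncomputable section

open IsLocalRing MvPolynomial Literature.AlgebraicGeometry.Resolution
open Summit.ResolutionOfSingularities.ResolutionOfSingularities.Cruxes.HypersurfaceCentreConstruction.LocalEngine

set_option linter.dupNamespace false -- mandated namespace of this single-conjunct summit

namespace Summit.ResolutionOfSingularities.ResolutionOfSingularities.Theorems

namespace JFlatEssSmooth

open IotaOrderEssSmooth (mem_maximalIdeal_pow_iff_of_formallySmooth)

/-! ## §1 Linear forms -/

section Linear

variable {K : Type} [CommRing K]

/-- **A `(1,1,1)`-form of weight one is linear**: `F = F₀ Y + F₁ U₁ + F₂ U₂` with `Fᵢ` the coefficients of the variables.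
[folklore] -/
theorem eq_linear_of_isWeightedHomogeneous_one {F : MvPolynomial (Fin 3) K}
    (hF : F.IsWeightedHomogeneous ![1, 1, 1] 1) :
    F = C (F.coeff (Finsupp.single 0 1)) * X 0 + C (F.coeff (Finsupp.single 1 1)) * X 1 +
      C (F.coeff (Finsupp.single 2 1)) * X 2 := by
  classical
  ext m
  simp only [coeff_add, coeff_C_mul, coeff_X, mul_ite, mul_one, mul_zero]
  by_cases h0 : Finsupp.single (0 : Fin 3) 1 = m
  · subst h0; simp [Finsupp.single_eq_single_iff]
  by_cases h1 : Finsupp.single (1 : Fin 3) 1 = m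
  · subst h1; simp [Finsupp.single_eq_single_iff]
  by_cases h2 : Finsupp.single (2 : Fin 3) 1 = m
  · subst h2; simp [Finsupp.single_eq_single_iff]
  rw [if_neg h0, if_neg h1, if_neg h2, add_zero, add_zero]
  by_contra hne
  have hw := hF hne
  rw [weight_b11_eq] at hw
  have key : m = Finsupp.single 0 (m 0) + Finsupp.single 1 (m 1) + Finsupp.single 2 (m 2) := by
    ext i; fin_cases i <;> simp
  rcases (show (m 0 = 1 ∧ m 1 = 0 ∧ m 2 = 0) ∨ (m 0 = 0 ∧ m 1 = 1 ∧ m 2 = 0) ∨ (m 0 = 0 ∧ m 1 = 0 ∧ m 2 = 1) by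
    omega) with ⟨h0', h1', h2'⟩ | ⟨h0', h1', h2'⟩ | ⟨h0', h1', h2'⟩
  · exact h0 (by rw [key, h0', h1', h2']; simp)
  · exact h1 (by rw [key, h0', h1', h2']; simp)
  · exact h2 (by rw [key, h0', h1', h2']; simp)

end Linear

/-! ## §2 The rational correction at the level `b = 1` -/

section Descent

variable {S S' : Type} [CommRing S] [CommRing S'] [IsRegularLocalRing S] [IsRegularLocalRing S'] [Algebra S S']
  [IsLocalHom (algebraMap S S')] [Algebra.FormallySmooth S S'] [Algebra.EssFiniteType S S']

/-- **DESCENT OF THE FIRST CONTACT LEVEL, DIMENSION THREE (the rational tangent direction).**  `φ : S → S'` a local,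
formally smooth, essentially-of-finite-type homomorphism of regular local rings with `𝔪_S S' = 𝔪_{S'}` and `dim S' = 3`;
`c = (y, x₁, x₂)` a regular system of parameters of `S`; `f ∈ 𝔪^ν ∖ 𝔪^{ν+1}` (`ν ≥ 1`); `g' ∈ 𝔪'` carrying `φ f` to level
`2` with `g' ∉ (φ x₁, φ x₂) + 𝔪'²`.  Then `g' ≡ u · φ(y + r) (mod 𝔪'²)` for some `r ∈ 𝔪_S` with `y + r ∉ 𝔪_S²` and a unit `u`
— the hypothesis `hcorr` of PART 6a `bMax_map_eq_of_corrections` at `b = 1`, in the coordinates `c`.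
[cite: Hironaka1967, §3] [OURS · L1 W4.3 · (o53) GAP 1″] -/
theorem exists_correction_one (h𝔪 : (maximalIdeal S).map (algebraMap S S') = maximalIdeal S')
    (hdim' : ringKrullDim S' = 3) (c : Fin 3 → S) (hgen : Ideal.span {c 0, c 1, c 2} = maximalIdeal S)
    {f : S} {ν : ℕ} (hν : 1 ≤ ν) (hford : f ∉ maximalIdeal S ^ (ν + 1)) (hfν : f ∈ maximalIdeal S ^ ν)
    {g' : S'} (hg' : g' ∈ maximalIdeal S')
    (hl : g' ∉ Ideal.span {algebraMap S S' (c 1), algebraMap S S' (c 2)} ⊔ maximalIdeal S' ^ 2)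
    (hfg' : algebraMap S S' f ∈ contactFiltration g' (1 + 1) ((1 + 1) * ν)) :
    ∃ (r : S) (u : S'), r ∈ maximalIdeal S ∧ c 0 + r ∉ maximalIdeal S ^ 2 ∧ IsUnit u ∧
      g' - u * algebraMap S S' (c 0 + r) ∈ maximalIdeal S' ^ (1 + 1) := by
  classical
  haveI := FormallySmoothField.formallySmooth_residueField S S' h𝔪
  haveI := FormallySmoothField.essFiniteType_residueField S S'
  have h111 : (![1, 1, 1] : Fin 3 → ℕ) = fun _ => 1 := by funext i; fin_cases i <;> rfl
  have hgenr : Ideal.span (Set.range c) = maximalIdeal S := span_range_eq_of_span_triple c hgen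
  have hci : ∀ i, c i ∈ maximalIdeal S := fun i => hgenr ▸ Ideal.subset_span ⟨i, rfl⟩
  have hc'i : ∀ i, (algebraMap S S' ∘ c) i ∈ maximalIdeal S' := fun i => h𝔪 ▸ Ideal.mem_map_of_mem _ (hci i)
  have hgen' : Ideal.span {algebraMap S S' (c 0), algebraMap S S' (c 1), algebraMap S S' (c 2)} = maximalIdeal S' := by
    rw [← h𝔪, ← hgen, Ideal.map_span, Set.image_insert_eq, Set.image_insert_eq, Set.image_singleton]
  have hgen'3 : Ideal.span {(algebraMap S S' ∘ c) 0, (algebraMap S S' ∘ c) 1, (algebraMap S S' ∘ c) 2} =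
      maximalIdeal S' := hgen'
  have hgen'r : Ideal.span (Set.range (algebraMap S S' ∘ c)) = maximalIdeal S' :=
    span_range_eq_of_span_triple _ hgen'3
  have hwpos : ∀ i, 0 < (![1, 1, 1] : Fin 3 → ℕ) i := fun i => by rw [h111]; exact Nat.one_pos
  have hW : ∀ n, weightedIdealW c ![1, 1, 1] n = maximalIdeal S ^ n := fun n => by
    rw [h111]; exact weightedIdealW_one_eq_pow c hgenr n
  have hW' : ∀ n, weightedIdealW (algebraMap S S' ∘ c) ![1, 1, 1] n = maximalIdeal S' ^ n := fun n => by
    rw [h111]; exact weightedIdealW_one_eq_pow _ hgen'r n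
  have hford' : algebraMap S S' f ∉ maximalIdeal S' ^ (ν + 1) := fun h =>
    hford ((mem_maximalIdeal_pow_iff_of_formallySmooth S S' _ f).mpr h)
  -- Step B: `φ f = a g'^ν + h`, `h ∈ 𝔪'^{ν+1}`, `a` a unit
  obtain ⟨aν, haν, h, hh, hsum⟩ := Submodule.mem_sup.mp (mem_span_pow_sup_of_level_succ g' 1 ν hfg')
  obtain ⟨a, rfl⟩ := Ideal.mem_span_singleton'.mp haν
  have ha : IsUnit a := isUnit_of_level_face hg' le_rfl hsum.symm hh hford'
  have ha0 : residue S' a ≠ 0 := fun h0 =>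
    (IsLocalRing.mem_maximalIdeal a).mp ((residue_eq_zero_iff a).mp h0) ha
  have hh' : h ∈ maximalIdeal S' ^ (ν + 1) := contactFiltration_le_pow_maximalIdeal_succ g' hg' le_rfl ν hh
  -- `in_1(g') = L`, a linear form `l₀ Y + l₁ U₁ + l₂ U₂`
  obtain ⟨L, hL⟩ := exists_isInForm_of_mem (algebraMap S S' ∘ c) ![1, 1, 1] (n := 1) (f := g')
    (by rw [hW', pow_one]; exact hg')
  obtain ⟨F, hFhom, hFL, hFrem⟩ := hL
  have hin_g' : IsInForm (algebraMap S S' ∘ c) ![1, 1, 1] 1 g' L := ⟨F, hFhom, hFL, hFrem⟩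
  have hFlin := eq_linear_of_isWeightedHomogeneous_one hFhom
  set F₀ := F.coeff (Finsupp.single 0 1) with hF₀
  set F₁ := F.coeff (Finsupp.single 1 1) with hF₁
  set F₂ := F.coeff (Finsupp.single 2 1) with hF₂
  have hLlin : L = C (residue S' F₀) * X 0 + C (residue S' F₁) * X 1 + C (residue S' F₂) * X 2 := by
    rw [← hFL, hFlin]
    simp [map_X, map_C]
  -- `F₀` is a unit: otherwise `g' ∈ (φ x₁, φ x₂) + 𝔪'²`
  have hF₀u : IsUnit F₀ := by
    by_contra hnu
    have hF₀m : F₀ ∈ maximalIdeal S' := (IsLocalRing.mem_maximalIdeal _).mpr hnu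
    apply hl
    have heval : eval (algebraMap S S' ∘ c) F =
        F₀ * algebraMap S S' (c 0) + F₁ * algebraMap S S' (c 1) + F₂ * algebraMap S S' (c 2) := by
      conv_lhs => rw [hFlin]
      simp [eval_C, eval_X]
    have hrem : g' - eval (algebraMap S S' ∘ c) F ∈ maximalIdeal S' ^ 2 := by
      rw [← hW']; exact hFrem
    have hsplit : g' = (F₁ * algebraMap S S' (c 1) + F₂ * algebraMap S S' (c 2)) +
        ((g' - eval (algebraMap S S' ∘ c) F) + F₀ * algebraMap S S' (c 0)) := by
      rw [heval]; ring
    rw [hsplit]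
    refine Submodule.add_mem_sup ?_ (Ideal.add_mem _ hrem ?_)
    · exact Ideal.add_mem _ (Ideal.mul_mem_left _ _ (Ideal.subset_span (by simp)))
        (Ideal.mul_mem_left _ _ (Ideal.subset_span (by simp)))
    · rw [pow_two]
      exact Ideal.mul_mem_mul hF₀m (hc'i 0)
  have hl0 : residue S' F₀ ≠ 0 := fun h0 =>
    (IsLocalRing.mem_maximalIdeal _).mp ((residue_eq_zero_iff _).mp h0) hF₀u
  -- `in_ν(φ f) = ā L^ν = in_ν(f) ⊗ κ(S')`
  have hin_rhs : IsInForm (algebraMap S S' ∘ c) ![1, 1, 1] ν (algebraMap S S' f) (C (residue S' a) * L ^ ν) := by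
    have h1 := IsInForm.smul _ (IsInForm.pow (algebraMap S S' ∘ c) hin_g' ν) a
    rw [one_mul] at h1
    have h2 : IsInForm (algebraMap S S' ∘ c) ![1, 1, 1] ν h 0 :=
      isInForm_zero_of_mem_succ _ (by rw [hW']; exact hh')
    have h3 := IsInForm.add _ h1 h2
    rw [add_zero, hsum] at h3
    exact h3
  obtain ⟨P, hP⟩ := exists_isInForm_of_mem c ![1, 1, 1] (n := ν) (f := f) (by rw [hW]; exact hfν)
  have hin_lhs : IsInForm (algebraMap S S' ∘ c) ![1, 1, 1] ν (algebraMap S S' f)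
      (MvPolynomial.map (algebraMap (ResidueField S) (ResidueField S')) P) := IsInForm.baseChange hP
  have hPQ := IsInForm.unique _ hgen'3 hdim' hwpos hin_lhs hin_rhs
  -- normal form `L = l₀ (Y + R)`, `R = (l₁/l₀) U₁ + (l₂/l₀) U₂`
  set l₀ := residue S' F₀ with hl₀
  set R : MvPolynomial (Fin 3) (ResidueField S') :=
    C (residue S' F₁ / l₀) * X 1 + C (residue S' F₂ / l₀) * X 2 with hRdef
  have hLR : L = C l₀ * (X 0 + R) := by
    rw [hLlin, hRdef, mul_add, mul_add, ← mul_assoc, ← mul_assoc, ← C_mul, ← C_mul,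
      mul_div_cancel₀ _ hl0, mul_div_cancel₀ _ hl0, add_assoc]
  have hRface : ∀ m ∈ R.support, m 0 = 0 ∧ m 1 + m 2 = 1 := by
    intro m hm
    rw [mem_support_iff, hRdef] at hm
    simp only [coeff_add, coeff_C_mul, coeff_X, mul_ite, mul_one, mul_zero] at hm
    by_cases h1 : Finsupp.single (1 : Fin 3) 1 = m
    · subst h1; simp
    by_cases h2 : Finsupp.single (2 : Fin 3) 1 = m
    · subst h2; simp
    rw [if_neg h1, if_neg h2, add_zero] at hm
    exact absurd rfl hm
  have hPQ' : MvPolynomial.map (algebraMap (ResidueField S) (ResidueField S')) P =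
      C (residue S' a * l₀ ^ ν) * (X 0 + R) ^ ν := by
    rw [hPQ, hLR, mul_pow, ← C_pow, ← mul_assoc, ← C_mul]
  have hal0 : residue S' a * l₀ ^ ν ≠ 0 := mul_ne_zero ha0 (pow_ne_zero _ hl0)
  -- Step C (`d = 1`): `R` is rational; Step D: lift it to `r ∈ (x₁, x₂)`
  obtain ⟨R₀, hR₀⟩ :=
    exists_eq_map_of_face_identity (ResidueField S) (ResidueField S') hν hal0 hRface hPQ'
  obtain ⟨r, hr1, hin_r⟩ := exists_eval_isInForm_of_polynomial c (hci 1) (hci 2) 1 1 R₀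
  have hr𝔪 : r ∈ maximalIdeal S := by rwa [pow_one] at hr1
  have hin_φr : IsInForm (algebraMap S S' ∘ c) ![1, 1, 1] 1 (algebraMap S S' r) R := by
    have := IsInForm.baseChange (T := S') hin_r
    rwa [← hR₀] at this
  have hin_y : IsInForm (algebraMap S S' ∘ c) ![1, 1, 1] 1 (algebraMap S S' (c 0)) (X 0) :=
    isInForm_coord_zero (algebraMap S S' ∘ c) ![1, 1, 1]
  have hin_corr : IsInForm (algebraMap S S' ∘ c) ![1, 1, 1] 1 (F₀ * algebraMap S S' (c 0 + r)) L := by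
    have := IsInForm.smul _ (IsInForm.add _ hin_y hin_φr) F₀
    rw [← hl₀, ← hLR, ← map_add] at this
    exact this
  -- Step E: `g' - F₀ φ(y + r) ∈ 𝔪'²`
  have hdiff : g' - F₀ * algebraMap S S' (c 0 + r) ∈ maximalIdeal S' ^ (1 + 1) := by
    have := IsInForm.sub _ hin_g' hin_corr
    rw [sub_self] at this
    rw [← hW']
    exact IsInForm.mem_succ_of_zero _ hgen'r hwpos this
  refine ⟨r, F₀, hr𝔪, ?_, hF₀u, hdiff⟩
  intro h2
  apply hl
  refine Submodule.mem_sup_right ?_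
  have hsplit : g' = (g' - F₀ * algebraMap S S' (c 0 + r)) + F₀ * algebraMap S S' (c 0 + r) := by ring
  rw [hsplit]
  refine Ideal.add_mem _ hdiff (Ideal.mul_mem_left _ _ ?_)
  have := Ideal.mem_map_of_mem (algebraMap S S') h2
  rwa [Ideal.map_pow, h𝔪] at this

end Descent

end JFlatEssSmooth

end Summit.ResolutionOfSingularities.ResolutionOfSingularities.Theorems

end
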